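import Literature.Analysis.UnboundedOperators.SelfAdjointExtensions
import Mathlib.Analysis.InnerProductSpace.Adjoint
import Mathlib.Analysis.Normed.Operator.Compact.Basic
import HarnessLib

/-!
# The operator associated with a closed symmetric form (Kato's first representation theorem)

RH-FREE library file (abstract Hilbert-space operator theory; no number theory).

**Setting (the `(Q, J)` format of `Literature/Analysis/OperatorTheory/CompactEmbeddingFormSpectrum`).**
A densely defined, closed, symmetric form `𝔥 ≥ γ` on a Hilbert space `H` is recorded through its
form domain made into a Hilbert space: `Q` is a Hilbert space and `J : Q →L[ℂ] H` an injective bounded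
map with dense range (the inclusion `D(𝔥) ↪ H`), the inner product of `Q` being `(𝔥 + 1)[x, y]`
(Kato's `H_𝔥`, VI §1.3 (1.29) and §2.2); the form itself is then

  `𝔥[x, y] = ⟪x, y⟫_Q − ⟪J x, J y⟫_H`,  `𝔥[x] = ‖x‖_Q² − ‖J x‖_H²`.

**Kato VI Thm 2.1 / Thm 2.6 (Friedrichs).** There is a unique self-adjoint operator `T = T_𝔥` in `H`
with `D(T) ⊆ D(𝔥)` and `𝔥[u, v] = ⟪T u, v⟫` (`u ∈ D(T)`, `v ∈ D(𝔥)`); `D(T)` is a core of `𝔥`; and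
`u ∈ D(T), T u = w` as soon as `𝔥[u, v] = ⟪w, v⟫` for all `v` (Thm 2.1 (iii)).  Kato's proof (§2.2,
symmetric case, where his `B = 1`): the Riesz map `u ↦ u'`, `⟪u, J v⟫_H = ⟪u', v⟫_Q`, is `J†`, the
bounded injective operator `A = J J† ∈ 𝓑(H)` has range `D(T)`, and `T = A⁻¹ − 1`.

## Main declarations (namespace `Literature.Analysis.UnboundedOperators`)

* `formOperator J : H →ₗ.[ℂ] H` — `T_𝔥 = (J J†)⁻¹ − 1` on `D(T) = Ran (J J†)` (ONE definition);
* `mem_formOperator_domain_iff`, `formOperator_apply_comp` (`T (J J† f) = f − J J† f`),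
  `mem_formOperator_domain_of_inner_eq` / `formOperator_apply_of_inner_eq` (Thm 2.1 (iii)),
  `inner_formOperator_left` (Thm 2.1 (i), eq. (2.1)), `re_inner_formOperator_self`
  (`⟪T u, u⟫ = 𝔥[u]`, hence the lower bound `formOperator_lowerBound`, Thm 2.6),
  `dense_formOperator_domain`, `dense_formOperator_formDomain` (Thm 2.1 (ii): `D(T)` is a core),
  `formOperator_isSymmetric`, **`isSelfAdjoint_formOperator`** (Thm 2.6),
  `le_formOperator_of_inner_eq` (Cor 2.4), `eq_formOperator_of_isSelfAdjoint` (uniqueness),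
  `formOperator_apply_of_form_eigen` (form-eigenvectors of `CompactEmbeddingFormSpectrum` are
  eigenvectors of `T`), `isCompactOperator_resolvent_formOperator` (compact embedding ⟹ compact
  resolvent, Reed–Simon IV XIII.64 direction used with `CompactResolventEigenbasis`).

No named facts, no instances, no notation.  `-- TODO(general form):` sectorial (non-symmetric)
forms, Kato VI Thm 2.1 in full, and `RCLike 𝕜` scalars (the tree's `LinearPMap` self-adjointness
library is over `ℂ`).

## References
* T. Kato, *Perturbation Theory for Linear Operators* (1966), VI §2.1 Thm 2.1, Cor 2.4, Thm 2.6 and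
  §2.2 (proof), held text `book-kato1966-perturbation-theory-linear-operators` p0379–p0381.
  [Kato1966]
* M. Reed, B. Simon, *Methods of Modern Mathematical Physics I* (1980), Thm VIII.15 (Friedrichs
  extension via forms). [ReedSimonI1980]
-/

noncomputable section

open _root_.LinearPMap
open scoped InnerProductSpace ComplexConjugate

namespace Literature.Analysis.UnboundedOperators

variable {Q : Type*} [NormedAddCommGroup Q] [InnerProductSpace ℂ Q] [CompleteSpace Q]
variable {H : Type*} [NormedAddCommGroup H] [InnerProductSpace ℂ H] [CompleteSpace H]

/-! ## Kato's bounded operator `A = J J†` and the definition of `T_𝔥` -/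

/-- Kato's bounded operator `A = J J† ∈ 𝓑(H)` (VI §2.2: `A u = B⁻¹ u'` with `B = 1` in the symmetric
case and `u' = J† u` the Riesz representative of `v ↦ ⟪u, J v⟫`), as a partially defined operator on
all of `H` so that `LinearPMap.inverse` applies. [cite: Kato1966, VI §2.2 eq. (2.4)] -/
private def katoA (J : Q →L[ℂ] H) : H →ₗ.[ℂ] H :=
  ((J.comp (ContinuousLinearMap.adjoint J) : H →L[ℂ] H) : H →ₗ[ℂ] H).toPMap ⊤

/-- **The operator `T_𝔥` associated with the closed symmetric form `𝔥[x, y] = ⟪x, y⟫_Q − ⟪Jx, Jy⟫_H`**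
(Kato's first representation theorem, symmetric case = Friedrichs): `T = A⁻¹ − 1` where
`A = J J† ∈ 𝓑(H)`, on `D(T) = Ran A`.  (For `J` injective with dense range `A` is injective, so the
inverse is a genuine operator; otherwise this is junk.) [cite: Kato1966, VI §2.1 Thm 2.1 and §2.2 («`T = A⁻¹ − 1`, for every `w ∈ D(T) = R(A)`»), held p0379–p0380] -/
def formOperator (J : Q →L[ℂ] H) : H →ₗ.[ℂ] H where
  domain := (LinearPMap.inverse (katoA J)).domain
  toFun := (LinearPMap.inverse (katoA J)).toFun - (LinearPMap.inverse (katoA J)).domain.subtype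

variable {J : Q →L[ℂ] H}

/-- `u ∈ D(T_𝔥) ↔ u = J J† f` for some `f ∈ H` (`D(T) = R(A)`). [cite: Kato1966, VI §2.2 («`D(T) = R(A)`»), held p0380] -/
theorem mem_formOperator_domain_iff (J : Q →L[ℂ] H) {u : H} :
    u ∈ (formOperator J).domain ↔ ∃ f : H, J (ContinuousLinearMap.adjoint J f) = u := by
  change u ∈ (LinearPMap.inverse (katoA J)).domain ↔ _
  rw [LinearPMap.inverse_domain, LinearMap.mem_range]
  constructor
  · rintro ⟨x, hx⟩; exact ⟨x, hx⟩
  · rintro ⟨f, hf⟩; exact ⟨⟨f, trivial⟩, hf⟩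

/-- `J J† f ∈ D(T_𝔥)`. [cite: Kato1966, VI §2.2 («`D(T) = R(A)`»), held p0380] -/
theorem comp_adjoint_mem_formOperator_domain (J : Q →L[ℂ] H) (f : H) :
    J (ContinuousLinearMap.adjoint J f) ∈ (formOperator J).domain :=
  (mem_formOperator_domain_iff J).2 ⟨f, rfl⟩

/-- `J†` is injective when `J` has dense range (`N(T*) = R(T)ᗮ`). [cite: Kato1966, V §3.1 eq. (3.1) («`N(T*) = R(T)^⊥`»), held p0321] -/
theorem adjoint_injective_of_denseRange (hJd : DenseRange J) :
    Function.Injective (ContinuousLinearMap.adjoint J) := by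
  refine (injective_iff_map_eq_zero _).2 fun f hf ↦ ?_
  refine Dense.eq_zero_of_inner_right (𝕜 := ℂ) (S := Set.range J) hJd fun v hv ↦ ?_
  obtain ⟨x, rfl⟩ := hv
  rw [← ContinuousLinearMap.adjoint_inner_right, hf, inner_zero_right]

/-- `J†` has dense range when `J` is injective (`N(T) = R(T*)ᗮ`). [cite: Kato1966, V §3.1 eq. (3.1) («`N(T) = R(T*)^⊥`»), held p0321] -/
theorem denseRange_adjoint_of_injective (hJi : Function.Injective J) :
    DenseRange (ContinuousLinearMap.adjoint J) := by
  have h : (LinearMap.range (ContinuousLinearMap.adjoint J : H →ₗ[ℂ] Q)).topologicalClosure = ⊤ := by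
    rw [Submodule.topologicalClosure_eq_top_iff, Submodule.eq_bot_iff]
    intro y hy
    rw [Submodule.mem_orthogonal] at hy
    apply hJi
    rw [_root_.map_zero]
    refine Dense.eq_zero_of_inner_right (𝕜 := ℂ) dense_univ fun v _ ↦ ?_
    have := hy (ContinuousLinearMap.adjoint J v) ⟨v, rfl⟩
    rwa [ContinuousLinearMap.adjoint_inner_left] at this
  have h' := Submodule.dense_iff_topologicalClosure_eq_top.2 h
  rw [LinearMap.coe_range] at h'
  exact h'

/-- `A = J J†` is injective for `J` injective with dense range. [cite: Kato1966, VI §2.2 («A is invertible»), held p0380] -/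
private theorem katoA_ker_eq_bot (hJi : Function.Injective J) (hJd : DenseRange J) :
    LinearMap.ker (katoA J).toFun = ⊥ := by
  rw [LinearMap.ker_eq_bot']
  intro x hx
  have hx' : J (ContinuousLinearMap.adjoint J (x : H)) = 0 := hx
  have h1 : ContinuousLinearMap.adjoint J (x : H) = 0 := hJi (by rw [hx', _root_.map_zero])
  have h2 : (x : H) = 0 := adjoint_injective_of_denseRange hJd (by rw [h1, _root_.map_zero])
  exact Subtype.ext h2

/-- **`(T_𝔥 + 1)(J J† f) = f`**, i.e. `T (J J† f) = f − J J† f` (`T = A⁻¹ − 1`). [cite: Kato1966, VI §2.2 («`T = A⁻¹ − 1`»), held p0380] -/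
theorem formOperator_apply_comp (hJi : Function.Injective J) (hJd : DenseRange J) (f : H) :
    (formOperator J ⟨J (ContinuousLinearMap.adjoint J f), comp_adjoint_mem_formOperator_domain J f⟩
      : H) = f - J (ContinuousLinearMap.adjoint J f) := by
  have hinv : (LinearPMap.inverse (katoA J))
      ⟨J (ContinuousLinearMap.adjoint J f), comp_adjoint_mem_formOperator_domain J f⟩ = (f : H) := by
    have := LinearPMap.inverse_apply_eq (katoA_ker_eq_bot hJi hJd)
      (y := ⟨J (ContinuousLinearMap.adjoint J f), comp_adjoint_mem_formOperator_domain J f⟩)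
      (x := ⟨f, trivial⟩) rfl
    simpa using this
  change ((LinearPMap.inverse (katoA J)).toFun - (LinearPMap.inverse (katoA J)).domain.subtype)
    ⟨_, _⟩ = _
  rw [LinearMap.sub_apply, Submodule.subtype_apply]
  exact congrArg (fun v ↦ v - J (ContinuousLinearMap.adjoint J f)) hinv

/-- Every element of `D(T_𝔥)` in the form `u = J J† f`, with `T u = f − u`. [cite: Kato1966, VI §2.2, held p0380] -/
theorem exists_eq_comp_adjoint (hJi : Function.Injective J) (hJd : DenseRange J)
    (u : (formOperator J).domain) :
    ∃ f : H, J (ContinuousLinearMap.adjoint J f) = u ∧ (formOperator J u : H) = f - u := by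
  obtain ⟨f, hf⟩ := (mem_formOperator_domain_iff J).1 u.2
  refine ⟨f, hf, ?_⟩
  have hu : u = ⟨J (ContinuousLinearMap.adjoint J f), comp_adjoint_mem_formOperator_domain J f⟩ :=
    Subtype.ext hf.symm
  rw [hu, formOperator_apply_comp hJi hJd]

/-! ## Theorem 2.1 (i): `D(T) ⊆ D(𝔥)` and `𝔥[u, v] = ⟪T u, v⟫` -/

/-- **Thm 2.1 (i), `D(T) ⊆ D(𝔥)`**: every `u ∈ D(T_𝔥)` is `J x` with `x = J† (T u + u) ∈ Q`. [cite: Kato1966, VI §2.1 Thm 2.1 (i), held p0379] -/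
theorem formOperator_domain_subset_range (hJi : Function.Injective J) (hJd : DenseRange J)
    (u : (formOperator J).domain) :
    J (ContinuousLinearMap.adjoint J ((formOperator J u : H) + u)) = u := by
  obtain ⟨f, hf, hT⟩ := exists_eq_comp_adjoint hJi hJd u
  rw [hT, sub_add_cancel, hf]

/-- **Thm 2.1 (i), eq. (2.1): `𝔥[x, y] = ⟪T (J x), J y⟫`** for `J x ∈ D(T)` and every `y ∈ Q = D(𝔥)`,
with `𝔥[x, y] = ⟪x, y⟫_Q − ⟪J x, J y⟫_H`. [cite: Kato1966, VI §2.1 Thm 2.1 (i) eq. (2.1), held p0379] -/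
theorem inner_formOperator_left (hJi : Function.Injective J) (hJd : DenseRange J) {x : Q}
    (hx : J x ∈ (formOperator J).domain) (y : Q) :
    ⟪(formOperator J ⟨J x, hx⟩ : H), J y⟫_ℂ = ⟪x, y⟫_ℂ - ⟪J x, J y⟫_ℂ := by
  obtain ⟨f, hf, hT⟩ := exists_eq_comp_adjoint hJi hJd ⟨J x, hx⟩
  have hxf : x = ContinuousLinearMap.adjoint J f := hJi (by rw [hf])
  rw [hT, inner_sub_left]
  simp only
  rw [hxf, ContinuousLinearMap.adjoint_inner_left]

/-- **`⟪T u, u⟫ = 𝔥[u]`** (`u = J x`): `re ⟪T (J x), J x⟫ = ‖x‖_Q² − ‖J x‖²` (and the inner product is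
real). [cite: Kato1966, VI §2.2 («(Tu, u) = t[u] by (2.1)»), held p0380] -/
theorem re_inner_formOperator_self (hJi : Function.Injective J) (hJd : DenseRange J) {x : Q}
    (hx : J x ∈ (formOperator J).domain) :
    RCLike.re ⟪(formOperator J ⟨J x, hx⟩ : H), J x⟫_ℂ = ‖x‖ ^ 2 - ‖J x‖ ^ 2 := by
  rw [inner_formOperator_left hJi hJd hx x, _root_.map_sub, inner_self_eq_norm_sq (𝕜 := ℂ),
    inner_self_eq_norm_sq (𝕜 := ℂ)]

/-- **Thm 2.6, lower bound: `T` and `𝔥` have the same lower bound** — if `𝔥[x] ≥ γ ‖J x‖²` on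
`Q = D(𝔥)` then `re ⟪T u, u⟫ ≥ γ ‖u‖²` on `D(T)`. [cite: Kato1966, VI §2.1 Thm 2.6 («T and 𝔥 have the same lower bound»), held p0379] -/
theorem formOperator_lowerBound (hJi : Function.Injective J) (hJd : DenseRange J) {γ : ℝ}
    (hγ : ∀ x : Q, γ * ‖J x‖ ^ 2 ≤ ‖x‖ ^ 2 - ‖J x‖ ^ 2) (u : (formOperator J).domain) :
    γ * ‖(u : H)‖ ^ 2 ≤ RCLike.re ⟪(formOperator J u : H), (u : H)⟫_ℂ := by
  set x : Q := ContinuousLinearMap.adjoint J ((formOperator J u : H) + u) with hxdef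
  have hxu : J x = u := formOperator_domain_subset_range hJi hJd u
  have hmem : J x ∈ (formOperator J).domain := by rw [hxu]; exact u.2
  have hu : u = ⟨J x, hmem⟩ := Subtype.ext hxu.symm
  rw [hu]
  simp only
  rw [re_inner_formOperator_self hJi hJd hmem]
  exact hγ x

/-! ## Theorem 2.1 (iii) and Corollary 2.4 -/

/-- **Thm 2.1 (iii)**: if `x ∈ Q = D(𝔥)`, `w ∈ H` and `𝔥[x, y] = ⟪w, J y⟫` for all `y ∈ Q`, then
`J x ∈ D(T)` (and `T (J x) = w`, next lemma). [cite: Kato1966, VI §2.1 Thm 2.1 (iii), held p0379; proof §2.2 p0381] -/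
theorem mem_formOperator_domain_of_inner_eq {x : Q} {w : H}
    (h : ∀ y : Q, ⟪x, y⟫_ℂ - ⟪J x, J y⟫_ℂ = ⟪w, J y⟫_ℂ) : J x ∈ (formOperator J).domain := by
  -- `⟪x, y⟫_Q = ⟪w + J x, J y⟫ = ⟪J† (w + J x), y⟫_Q`, so `x = J† (w + J x)`
  have hx : x = ContinuousLinearMap.adjoint J (w + J x) := by
    rw [← sub_eq_zero]
    refine Dense.eq_zero_of_inner_left (𝕜 := ℂ) dense_univ fun y _ ↦ ?_
    rw [inner_sub_left, ContinuousLinearMap.adjoint_inner_left, inner_add_left, ← h y]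
    ring
  rw [hx]
  exact comp_adjoint_mem_formOperator_domain J _

/-- **Thm 2.1 (iii)**: under the same hypothesis, `T (J x) = w`. [cite: Kato1966, VI §2.1 Thm 2.1 (iii), held p0379; proof §2.2 p0381] -/
theorem formOperator_apply_of_inner_eq (hJi : Function.Injective J) (hJd : DenseRange J) {x : Q}
    {w : H} (h : ∀ y : Q, ⟪x, y⟫_ℂ - ⟪J x, J y⟫_ℂ = ⟪w, J y⟫_ℂ)
    (hx : J x ∈ (formOperator J).domain) : (formOperator J ⟨J x, hx⟩ : H) = w := by
  refine Dense.eq_zero_of_inner_left (𝕜 := ℂ) (S := Set.range J) hJd (fun v hv ↦ ?_) |>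
    (sub_eq_zero.1 ·)
  obtain ⟨y, rfl⟩ := hv
  rw [inner_sub_left, inner_formOperator_left hJi hJd hx y, h y, sub_self]

/-- **Cor 2.4**: an operator `S` with `D(S) ⊆ D(𝔥)` and `𝔥[u, v] = ⟪S u, v⟫` (`u ∈ D(S)`, `v ∈ D(𝔥)`)
satisfies `S ⊆ T_𝔥`. [cite: Kato1966, VI §2.1 Cor 2.4, held p0379] -/
theorem le_formOperator_of_inner_eq (hJi : Function.Injective J) (hJd : DenseRange J)
    {S : H →ₗ.[ℂ] H}
    (hS : ∀ u : S.domain, ∃ x : Q, J x = u ∧ ∀ y : Q, ⟪x, y⟫_ℂ - ⟪J x, J y⟫_ℂ = ⟪(S u : H), J y⟫_ℂ) :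
    S ≤ formOperator J := by
  refine ⟨fun u hu ↦ ?_, fun u v huv ↦ ?_⟩
  · obtain ⟨x, hxu, hx⟩ := hS ⟨u, hu⟩
    have hu' : u = J x := hxu.symm
    rw [hu']
    exact mem_formOperator_domain_of_inner_eq hx
  · obtain ⟨x, hxu, hx⟩ := hS u
    have hmem : J x ∈ (formOperator J).domain := mem_formOperator_domain_of_inner_eq hx
    have hv : v = ⟨J x, hmem⟩ := Subtype.ext (by rw [← huv]; exact hxu.symm)
    rw [hv, formOperator_apply_of_inner_eq hJi hJd hx hmem]

/-! ## Symmetry, density, self-adjointness (Theorem 2.6) -/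

/-- `T_𝔥` is symmetric. [cite: Kato1966, VI §2.1 Thm 2.6, held p0379] -/
theorem formOperator_isSymmetric (hJi : Function.Injective J) (hJd : DenseRange J) :
    (formOperator J).IsSymmetric := by
  intro u v
  obtain ⟨f, hf, hTu⟩ := exists_eq_comp_adjoint hJi hJd u
  obtain ⟨g, hg, hTv⟩ := exists_eq_comp_adjoint hJi hJd v
  rw [hTu, hTv, ← hf, ← hg, inner_sub_left, inner_sub_right]
  have e1 : ⟪f, J (ContinuousLinearMap.adjoint J g)⟫_ℂ =
      ⟪ContinuousLinearMap.adjoint J f, ContinuousLinearMap.adjoint J g⟫_ℂ :=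
    (ContinuousLinearMap.adjoint_inner_left J (ContinuousLinearMap.adjoint J g) f).symm
  have e2 : ⟪J (ContinuousLinearMap.adjoint J f), g⟫_ℂ =
      ⟪ContinuousLinearMap.adjoint J f, ContinuousLinearMap.adjoint J g⟫_ℂ :=
    (ContinuousLinearMap.adjoint_inner_right J (ContinuousLinearMap.adjoint J f) g).symm
  rw [e1, e2]

/-- `D(T_𝔥)` is dense in `H`. [cite: Kato1966, VI §2.1 Thm 2.1 (densely defined form, `T` m-sectorial), held p0379] -/
theorem dense_formOperator_domain (hJi : Function.Injective J) (hJd : DenseRange J) :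
    Dense ((formOperator J).domain : Set H) := by
  have h : DenseRange (fun f : H ↦ J (ContinuousLinearMap.adjoint J f)) :=
    hJd.comp (denseRange_adjoint_of_injective hJi) J.continuous
  refine h.mono ?_
  rintro _ ⟨f, rfl⟩
  exact comp_adjoint_mem_formOperator_domain J f

/-- **Thm 2.1 (ii): `D(T)` is a core of `𝔥`** — the form-domain elements `x` with `J x ∈ D(T)` are
dense in `Q = (D(𝔥), ‖·‖_𝔥)` (they contain `Ran J†`). [cite: Kato1966, VI §2.1 Thm 2.1 (ii), held p0379; proof §2.2 p0380] -/
theorem dense_formOperator_formDomain (hJi : Function.Injective J) :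
    Dense {x : Q | J x ∈ (formOperator J).domain} := by
  refine (denseRange_adjoint_of_injective hJi).mono ?_
  rintro _ ⟨f, rfl⟩
  exact comp_adjoint_mem_formOperator_domain J f

/-- `Ran (T_𝔥 + 1) = H` (`R(T + 1) = R(A⁻¹) = D(A) = H`). [cite: Kato1966, VI §2.2 («T is m-sectorial, for `R(T+1) = R(A⁻¹) = D(A) = H`»), held p0380] -/
theorem range_formOperator_add_one (hJi : Function.Injective J) (hJd : DenseRange J) :
    LinearMap.range (subSMul (formOperator J) (-1)) = ⊤ := by
  rw [LinearMap.range_eq_top]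
  intro f
  refine ⟨⟨J (ContinuousLinearMap.adjoint J f), comp_adjoint_mem_formOperator_domain J f⟩, ?_⟩
  rw [subSMul_apply, formOperator_apply_comp hJi hJd]
  simp

/-- **Kato VI Thm 2.6 (Friedrichs): the operator associated with a densely defined closed symmetric
form bounded from below is SELF-ADJOINT.** [cite: Kato1966, VI §2.1 Thm 2.6, held p0379; proof §2.2 p0381] -/
theorem isSelfAdjoint_formOperator (hJi : Function.Injective J) (hJd : DenseRange J) :
    IsSelfAdjoint (formOperator J) := by
  refine isSelfAdjoint_of_isSymmetric_of_range_eq_top (formOperator_isSymmetric hJi hJd)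
    (dense_formOperator_domain hJi hJd) (z := -1) (range_formOperator_add_one hJi hJd) ?_
  have : (starRingEnd ℂ) (-1 : ℂ) = -1 := by simp
  rw [this]
  exact range_formOperator_add_one hJi hJd

/-- **Uniqueness (Thm 2.1, last clause + Cor 2.4): a SELF-ADJOINT `S` with `D(S) ⊆ D(𝔥)` and
`𝔥[u, v] = ⟪S u, v⟫` is `T_𝔥`.** [cite: Kato1966, VI §2.1 Thm 2.1 («uniquely determined by the condition i)») and Cor 2.4, held p0379] -/
theorem eq_formOperator_of_isSelfAdjoint (hJi : Function.Injective J) (hJd : DenseRange J)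
    {S : H →ₗ.[ℂ] H} (hSsa : IsSelfAdjoint S)
    (hS : ∀ u : S.domain, ∃ x : Q, J x = u ∧ ∀ y : Q, ⟪x, y⟫_ℂ - ⟪J x, J y⟫_ℂ = ⟪(S u : H), J y⟫_ℂ) :
    S = formOperator J :=
  eq_of_isSelfAdjoint_of_le_of_isSymmetric hSsa (le_formOperator_of_inner_eq hJi hJd hS)
    (formOperator_isSymmetric hJi hJd)

/-! ## Eigenvectors and compact resolvent -/

/-- **Form-eigenvectors are eigenvectors of `T_𝔥`**: if `⟪e, y⟫_Q = (λ + 1) ⟪J e, J y⟫_H` for all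
`y ∈ Q` (the weak eigen-equation delivered by `exists_hilbertBasis_form_hasSum`), then `J e ∈ D(T)`
and `T (J e) = λ J e`. [cite: Kato1966, VI §2.1 Thm 2.1 (iii), held p0379] -/
theorem formOperator_apply_of_form_eigen (hJi : Function.Injective J) (hJd : DenseRange J) {e : Q}
    {lam : ℝ} (h : ∀ y : Q, ⟪e, y⟫_ℂ = ((lam + 1 : ℝ) : ℂ) * ⟪J e, J y⟫_ℂ) :
    ∃ hmem : J e ∈ (formOperator J).domain, (formOperator J ⟨J e, hmem⟩ : H) = (lam : ℂ) • J e := by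
  have h' : ∀ y : Q, ⟪e, y⟫_ℂ - ⟪J e, J y⟫_ℂ = ⟪(lam : ℂ) • J e, J y⟫_ℂ := fun y ↦ by
    rw [h y, inner_smul_left, Complex.conj_ofReal]
    push_cast
    ring
  exact ⟨mem_formOperator_domain_of_inner_eq h', formOperator_apply_of_inner_eq hJi hJd h' _⟩

/-- The resolvent of `T_𝔥` at a non-real `z` factors through `A = J J†`:
`R(z) = J J† (1 + (z + 1) R(z))`. [cite: Kato1966, VI §2.2 («`T = A⁻¹ − 1`»), held p0380] -/
theorem resolvent_formOperator_eq (hJi : Function.Injective J) (hJd : DenseRange J) {z : ℂ}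
    (hz : z.im ≠ 0) (f : H) :
    resolvent (isSelfAdjoint_formOperator hJi hJd) hz f =
      J (ContinuousLinearMap.adjoint J
        (f + (z + 1) • resolvent (isSelfAdjoint_formOperator hJi hJd) hz f)) := by
  set hT := isSelfAdjoint_formOperator hJi hJd
  set u : (formOperator J).domain := ⟨resolvent hT hz f, resolvent_mem_domain hT hz f⟩ with hudef
  have hTu : (formOperator J u : H) = f + z • resolvent hT hz f := map_resolvent hT hz f
  have hx := formOperator_domain_subset_range hJi hJd u
  rw [hTu] at hx
  have e : f + z • resolvent hT hz f + (u : H) = f + (z + 1) • resolvent hT hz f := by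
    rw [hudef, add_smul, one_smul, add_assoc]
  rw [e] at hx
  exact hx.symm

/-- **Compact embedding ⟹ compact resolvent**: if `J` is a compact operator (Rellich-type
embedding of the form domain), the self-adjoint operator `T_𝔥` has compact resolvent — the input of
the tree's `exists_hilbertBasis_eigenvectors_of_compact_resolvent` (Reed–Simon IV Thm XIII.64).
[cite: Kato1966, VI §2.2 (`T = A⁻¹ − 1`, `A = J J†`), held p0380] -/
theorem isCompactOperator_resolvent_formOperator (hJi : Function.Injective J) (hJd : DenseRange J)
    (hJc : IsCompactOperator J) {z : ℂ} (hz : z.im ≠ 0) :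
    IsCompactOperator (resolvent (isSelfAdjoint_formOperator hJi hJd) hz) := by
  set R := resolvent (isSelfAdjoint_formOperator hJi hJd) hz
  have hB : IsCompactOperator (J.comp (ContinuousLinearMap.adjoint J) : H →L[ℂ] H) :=
    hJc.comp_clm (ContinuousLinearMap.adjoint J)
  have hcomp := hB.comp_clm ((1 : H →L[ℂ] H) + (z + 1) • R)
  have hfun : (⇑(J.comp (ContinuousLinearMap.adjoint J) : H →L[ℂ] H) ∘
      ⇑((1 : H →L[ℂ] H) + (z + 1) • R) : H → H) = ⇑R := by
    funext f
    exact (resolvent_formOperator_eq hJi hJd hz f).symm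
  rwa [hfun] at hcomp

end Literature.Analysis.UnboundedOperators

end
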